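import Summits.QuantumFields.BalabanUV.Beta.D1BFx.CoframeWordsKfour
import Summits.QuantumFields.BalabanUV.Beta.D1BFx.CoframeMassAlgebra
import Summits.QuantumFields.BalabanUV.Beta.D1BFx.PackedColumnEnvelope
import Literature.MathematicalPhysics.QuantumFieldTheory.Balaban1983to89.Beta.LatticeConstantZl

/-!
# `BalabanUV.Beta.D1BFx.CoframeMassUniform` — road «BF-x» for binder row D1, slot (K), (II)-row (C2) «TB4-W CO-FRAME TABLE, m-UNIFORM MASS»,
# FILE δ4b «COFRAME-MASS-UNIFORM»: **THE TOTAL MASS OF THE CO-FRAME PAIR TABLE `cofPairInf` AT THE ROAD's WEIGHTS `colH G₀ (m+1) μ y`, WITH ONE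
# CONSTANT FOR ALL SCALES `m + 1 = L^k`** — the m-UNIFORM (C2) letter the END's PART 12b quantifies `∀ m` (leaf-03 `PackedCoframeMassRoad` header:
# «that m-UNIFORM letter needs the n-explicit count of the co-frame words … and is NOT claimed here» — it is proved here, on the scales `n = L^k`)

HONEST DEPENDENCY (cell records, verbatim): «continuum YM on T⁴ ⇐ BetaPertH ∧ nine spine estimates (0/9 proved); BetaPertH ⇐ (D1) ∧ (D4) ∧
CAP+tail; G-an2-4 gates asym, D1 and NE2/3/4.»  HONEST FRAMING (cell contract, verbatim): «discharging `BetaPertH` makes Bałaban's UV stability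
UNCONDITIONAL — a real constructive-QFT result; it is NOT the continuum limit and NOT the Clay problem.»  THIS MODULE DISCHARGES NOTHING of the
wall: [folklore] assembly of «G0-COL-ENV» (`PackedColumnEnvelope.abs_colH_G₀_road_le`), γ3's `exists_leg_masses` (lit-balaban's profile of `G_k(0)` through β1∕β2), δ3b's `totMass_cofPairInf` and δ4a's `poly_bound`.  No definition, no `def … : Prop`, nothing cited, 0 sorry.  0 root-level binders of row D1 discharged (hW ∕ hR-sockets ∕
hSX-socket ∕ D1Tel ∕ D1Rep = 0); (K) NOT closed; (C1)(C2) NOT closed here — this is the COUNT half of (C2) in `TotMass` currency; the block read-out `blk (W2NInf …)` and the END's `hWs∕hWm` sockets are leaf-03's objects half; NOT D1, NOT `BetaPertH`, NOT continuum, NOT Clay.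

ABSOLUTE RULE (cell charter, verbatim): «No internally-minted statement may enter as a cited fact. Every hypothesis is either kernel-proved in
this package or a verbatim quotation of a PUBLISHED theorem with page reference. The manuscript(s) under audit are NOT citable for their own
disputed steps — they are the thing under adjudication; programme-internal (2001/route/tribunal) claims are never citable.»

WHY.  ρ-g19-1 AMENDED split (C1)(C2) into an OBJECTS half (leaf-03: `cofPairInf`, `W2NInf`, the block read-out, PER-SCALE masses in `Decays`∕`Zl`
currency — `PackedCoframeMassRoad.exists_mass_cofPairInf_road`, whose constants depend on `m`) and a COUNT half (this lineage: ONE constant for all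
scales).  The count runs in the `ℓ¹` mass currency of α1∕α2 (masses multiply with NO lattice constant per composition), reads the ghost leg's mass
from lit-balaban's profile of Bałaban's `G_k(0)` (β1∕β2 ⟹ γ1∕γ2∕γ3: `Ggh ≍ 1`, `lapU∘Ggh ≍ n⁻²`, `Pgt, Rgt ≍ 1`, `Cgh ≍ n⁴`, `lapU∘Cgh ≍ n²`,
`lapU∘Cgh∘lapU ≍ n⁰` at weights `θ ≤ θ₀∕n`), the vertices from the column envelope of `colH G₀` (`≍ n⁻⁴`, rate `κ′∕(16n)`), pays `Zl 4 (δ−θ) ≍ n⁴` ONCE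
per word, and keeps `e^{−θ|n•y − n•y′|₁} = e^{−θ₁|y−y′|₁}`: net `n⁰`, i.e. m-uniform, on `n = m+1 = L^k` (ρ-g19-2; the restriction is γ3's: the
profile of `G_k(0)` is Bałaban's `k`-step object).

CONTENT (all [folklore]).
* `Zl_road_le`: `κ′∕(32q) ≤ c`, `q ≥ 1` ⟹ `Zl 4 c ≤ q⁴·(1 + 64∕κ′)⁴` (`Zl_antitone`, `LatticeConstantZl.Zl_le_elem`).
* **`exists_totMass_cofPairInf_uniform (hL : 2 ≤ L) (ha : 0 < a) : ∃ KN θ₁, 0 < θ₁ ∧ ∀ k ≥ 1, ∀ m, m + 1 = L^k → ∀ r ∈ box 4 (m+1), ∀ μ ν y y′,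
  TotMass (cofPairInf (m+1) a (colH G₀ (m+1) μ y) (colH G₀ (m+1) ν y′)) (KN·e^{−θ₁|y−y′|₁})`**, `G₀ = coDressKBmAt (toSite r) (m+1) (KInvStep (m+1) 0)`,
  `θ₁ = min θ₀ (κ′∕32)`, `KN` the explicit (hidden) `|2|·P⋆` of δ4a at the road's constants.
NOT HERE: the block read-out `Σ'|blk (W2NInf m a r S₂ μ y ν y′) j i| ≤ mW j i·e^{−κ|y′−y|₁}` with ONE `mW` for all `m` (leaf-03's `exists_mass_blk_W2NInf`
re-run on this letter — its successor's junction), (C1) (the first-jet count, gradient letters; leaf-03 g25's parts), general `n` (not of the form `L^k`).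
Unit `b2b-balaban-gan24-formalise-leaf-05` (gen 54), G-an2-4 swarm leaf prover 05, road «BF-x» (C1)(C2) count owner (OWNER RULING ρ-g19-1 AMENDED l.43347,
ρ-g19-2: the END's currency is the subsequence `n = L^k`); INTENT «COFRAME WORDS ∕ UNIFORM» (journal).
-/

noncomputable section

namespace Summit.QuantumFields.BalabanUV.Beta.D1BFx.CoframeMassUniform

open scoped BigOperators
open Literature.MathematicalPhysics.QuantumFieldTheory.Balaban1983to89
open Literature.MathematicalPhysics.QuantumFieldTheory.Balaban1983to89.Beta
open B12Sec2to5 (l1 l1_nonneg)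
open B5Hk163Strip (kappa163 kappa163_pos)
open B5Hk163Decay (MG163)
open B4TorusKernel (periodConst)
open ExpKernelCalculus (Site MKer comp Zl Zl_pos l1_natSmul)
open AffineAveraging (box toSite)
open OneStepKernelFamily (colH KInvStep)
open LatticeConstantZl (Zl_le_elem)
open Summit.QuantumFields.BalabanUV.Beta.AxialDressingRooted (coDressKBmAt)
open Summit.QuantumFields.BalabanUV.Beta.D1BFx.KGhostLeg (Cgh)
open Summit.QuantumFields.BalabanUV.Beta.D1BFx.RJetProjector (Rgt)
open Summit.QuantumFields.BalabanUV.Beta.D1BFx.TorusGhostWordArrays (lapU)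
open Summit.QuantumFields.BalabanUV.Beta.D1BFx.PackedCoframePairLimit (cofPairInf)
open Summit.QuantumFields.BalabanUV.Beta.D1BFx.PackedColumnEnvelope (abs_colH_G₀_road_le)
open Summit.QuantumFields.BalabanUV.Beta.D1BFx.KernelMassCalculus
open Summit.QuantumFields.BalabanUV.Beta.D1BFx.KernelMassTotal
open Summit.QuantumFields.BalabanUV.Beta.D1BFx.CoframeVertices (const_nonneg)
open Summit.QuantumFields.BalabanUV.Beta.D1BFx.CompositeLegMasses (exists_leg_masses Zl_antitone)
open Summit.QuantumFields.BalabanUV.Beta.D1BFx.CoframeWordsKfour (totMass_cofPairInf)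
open Summit.QuantumFields.BalabanUV.Beta.D1BFx.CoframeMassAlgebra (poly_bound)

variable {a : ℝ}

/-- [folklore] The lattice constant at the road's rates: `Zl 4 (δ − θ) ≤ q⁴·(1 + 64∕κ′)⁴` when `δ − θ ≥ κ′∕(32q)`, `q ≥ 1`. -/
theorem Zl_road_le {q c : ℝ} (hq : 1 ≤ q) (hκ : 0 < kappa163 4) (hc : kappa163 4 / 32 / q ≤ c) :
    Zl 4 c ≤ q ^ 4 * (1 + 64 / kappa163 4) ^ 4 := by
  have hq0 : 0 < q := by linarith
  have hc0 : 0 < kappa163 4 / 32 / q := by positivity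
  refine (Zl_antitone hc0 hc).trans ((Zl_le_elem hc0 4).trans ?_)
  rw [← mul_pow]
  refine pow_le_pow_left₀ (by positivity) ?_ 4
  rw [show (2 : ℝ) / (kappa163 4 / 32 / q) = q * (64 / kappa163 4) by field_simp; ring, mul_add, mul_one]
  linarith

/-- [folklore] **«COFRAME-MASS-UNIFORM» — THE (C2) LETTER, m-UNIFORM ON THE SCALES `m + 1 = L^k`**: for `L ≥ 2`, `a > 0` there are `K_N` and `θ₁ > 0`
(functions of `L, a` only) such that for every `k ≥ 1`, `m + 1 = L^k`, `r ∈ box 4 (m+1)`, `μ ν y y′`: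
`TotMass (cofPairInf (m+1) a (colH G₀ (m+1) μ y) (colH G₀ (m+1) ν y′)) (K_N·e^{−θ₁|y−y′|₁})`, `G₀ = coDressKBmAt (toSite r) (m+1) (KInvStep (m+1) 0)`.
Assembly: the weights' envelope («G0-COL-ENV», amplitude `((m+1)⁴)⁻¹·c_E`, rate `κ′∕(16(m+1))`), γ3's leg masses at `θ = θ₁∕(m+1)`, δ3b's
`totMass_cofPairInf`, and δ4a's `poly_bound` (every monomial has `(m+1)`-degree `≤ 0`). -/
theorem exists_totMass_cofPairInf_uniform {L : ℕ} (hL : 2 ≤ L) (ha : 0 < a) :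
    ∃ KN θ₁ : ℝ, 0 < θ₁ ∧ ∀ (k : ℕ), 1 ≤ k → ∀ (m : ℕ), m + 1 = L ^ k → ∀ (rr : Fin (3 + 1) → ℕ), rr ∈ box (3 + 1) (m + 1) →
      ∀ (μ ν : Fin 4) (y y' : Fin 4 → ℤ),
        TotMass (cofPairInf (m + 1) a (colH (coDressKBmAt (toSite rr) (m + 1) (KInvStep (d := 3) (m + 1) 0)) (m + 1) μ y)
            (colH (coDressKBmAt (toSite rr) (m + 1) (KInvStep (d := 3) (m + 1) 0)) (m + 1) ν y'))
          (KN * Real.exp (-θ₁ * l1 (y - y'))) := by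
  obtain ⟨θ₀, g, π, hθ₀, hg, hπ, hM⟩ := exists_leg_masses (a := a) hL ha
  have hκ := kappa163_pos 4
  have hθ₁ : 0 < min θ₀ (kappa163 4 / 32) := lt_min hθ₀ (by positivity)
  exact ⟨_, min θ₀ (kappa163 4 / 32), hθ₁, fun k hk m hm rr hr μ ν y y' => by
    -- the scale `q = m + 1 ≥ 1` and the two rates
    have hq : (1 : ℝ) ≤ ((m + 1 : ℕ) : ℝ) := by exact_mod_cast Nat.succ_pos m
    have hq0 : (0 : ℝ) < ((m + 1 : ℕ) : ℝ) := by linarith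
    have hθ0 : 0 ≤ min θ₀ (kappa163 4 / 32) / ((m + 1 : ℕ) : ℝ) := by positivity
    have hθle : min θ₀ (kappa163 4 / 32) / ((m + 1 : ℕ) : ℝ) ≤ θ₀ / ((m + 1 : ℕ) : ℝ) :=
      div_le_div_of_nonneg_right (min_le_left _ _) hq0.le
    have eδ : kappa163 4 / 4 / (4 * ((m + 1 : ℕ) : ℝ)) = (kappa163 4 / 16) / ((m + 1 : ℕ) : ℝ) := by
      field_simp; ring
    have hθδ : min θ₀ (kappa163 4 / 32) / ((m + 1 : ℕ) : ℝ) < kappa163 4 / 4 / (4 * ((m + 1 : ℕ) : ℝ)) := by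
      rw [eδ]
      exact div_lt_div_of_pos_right (lt_of_le_of_lt (min_le_right _ _) (by linarith)) hq0
    -- the weights
    have hw := fun κ u => abs_colH_G₀_road_le m hr μ y κ u
    have hw' := fun κ u => abs_colH_G₀_road_le m hr ν y' κ u
    -- the legs at `θ = θ₁∕q`
    obtain ⟨-, -, -, hR, hC, hX, hXt, hY⟩ := hM k hk (m + 1) hm _ hθ0 hθle
    have eχ : ((m + 1 : ℕ) : ℝ) ^ 4 * ((((m + 1 : ℕ) : ℝ) ^ 2)⁻¹ * (1 + a * Real.exp (4 * θ₀) * g) * ((1 + π) * g))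
        = ((m + 1 : ℕ) : ℝ) ^ 2 * ((1 + a * Real.exp (4 * θ₀) * g) * ((1 + π) * g)) := by
      field_simp
    have eψ : ((m + 1 : ℕ) : ℝ) ^ 4 * ((((m + 1 : ℕ) : ℝ) ^ 2)⁻¹ * (1 + a * Real.exp (4 * θ₀) * g)
        * ((1 + π) * ((((m + 1 : ℕ) : ℝ) ^ 2)⁻¹ * (1 + a * Real.exp (4 * θ₀) * g))))
        = (1 + a * Real.exp (4 * θ₀) * g) * ((1 + π) * (1 + a * Real.exp (4 * θ₀) * g)) := by
      field_simp
    have hX' := And.intro (hX.1.mono le_rfl eχ.le) (hX.2.mono le_rfl eχ.le)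
    have hXt' := And.intro (hXt.1.mono le_rfl eχ.le) (hXt.2.mono le_rfl eχ.le)
    have hY' := And.intro (hY.1.mono le_rfl eψ.le) (hY.2.mono le_rfl eψ.le)
    have h := totMass_cofPairInf hw hw' hθ0 hθδ hX' hXt' hC hY' hR
    -- the separation factor in block units
    have eS : Real.exp (-(min θ₀ (kappa163 4 / 32) / ((m + 1 : ℕ) : ℝ)) * l1 (((m + 1 : ℕ) : ℤ) • y - ((m + 1 : ℕ) : ℤ) • y'))
        = Real.exp (-(min θ₀ (kappa163 4 / 32)) * l1 (y - y')) := by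
      rw [← smul_sub, l1_natSmul]
      congr 1
      field_simp
    rw [eS] at h
    -- the n-free majorant
    have hA : 0 ≤ 1 + a * Real.exp (4 * θ₀) * g := by
      have := mul_nonneg (mul_nonneg ha.le (Real.exp_pos (4 * θ₀)).le) hg
      linarith
    have hC0 : 0 ≤ (((m + 1 : ℕ) : ℝ) ^ 4)⁻¹ * (MG163 4 * periodConst (kappa163 4) 3
        * (1 + 8 * (1 + Real.exp (kappa163 4 / 4))) * Real.exp (kappa163 4 / 4)) := const_nonneg hw
    have hcE : MG163 4 * periodConst (kappa163 4) 3 * (1 + 8 * (1 + Real.exp (kappa163 4 / 4))) * Real.exp (kappa163 4 / 4)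
        = ((m + 1 : ℕ) : ℝ) ^ 4 * ((((m + 1 : ℕ) : ℝ) ^ 4)⁻¹ * (MG163 4 * periodConst (kappa163 4) 3
          * (1 + 8 * (1 + Real.exp (kappa163 4 / 4))) * Real.exp (kappa163 4 / 4))) := by
      field_simp
    have heδE : Real.exp (kappa163 4 / 4 / (4 * ((m + 1 : ℕ) : ℝ))) ≤ Real.exp (kappa163 4 / 16) := by
      rw [eδ, Real.exp_le_exp]
      exact div_le_self (by positivity) hq
    have heθE : Real.exp (min θ₀ (kappa163 4 / 32) / ((m + 1 : ℕ) : ℝ)) ≤ Real.exp (min θ₀ (kappa163 4 / 32)) := by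
      rw [Real.exp_le_exp]
      exact div_le_self hθ₁.le hq
    have hZ : Zl 4 (kappa163 4 / 4 / (4 * ((m + 1 : ℕ) : ℝ)) - min θ₀ (kappa163 4 / 32) / ((m + 1 : ℕ) : ℝ))
        ≤ ((m + 1 : ℕ) : ℝ) ^ 4 * (1 + 64 / kappa163 4) ^ 4 := by
      refine Zl_road_le hq hκ ?_
      rw [eδ, ← sub_div]
      refine div_le_div_of_nonneg_right ?_ hq0.le
      have := min_le_right θ₀ (kappa163 4 / 32)
      linarith
    exact totMass_mono h (poly_bound hq hC0 hcE (mul_nonneg hA (mul_nonneg (by linarith) hg)) (mul_nonneg hg (mul_nonneg (by linarith) hg))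
      (mul_nonneg hA (mul_nonneg (by linarith) hA)) (by linarith) (Real.exp_pos _).le heδE (Real.exp_pos _).le heθE
      (Zl_pos (by linarith)).le hZ (Real.exp_pos _).le)⟩

end Summit.QuantumFields.BalabanUV.Beta.D1BFx.CoframeMassUniform

end
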